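import Mathlib
import HarnessLib
import Summits.HubbardSuperconductivity.HubbardSuperconductivity.Theorems.KLProgrammeKLRegimeEngineTwoLegStepV17F2ZeroCloser
import Summits.HubbardSuperconductivity.HubbardSuperconductivity.Theorems.KLProgrammeKLRegimeEngineTwoLegStepV17F2Closers
import Summits.HubbardSuperconductivity.HubbardSuperconductivity.Theorems.KLProgrammeKLRegimeEngineV8DefsU9
import Summits.HubbardSuperconductivity.HubbardSuperconductivity.Theorems.KLProgrammeKLRegimeEngineV8DefsQ7
import Summits.HubbardSuperconductivity.HubbardSuperconductivity.Theorems.KLProgrammeKLRegimeTwoCutoffScaleZeroLegF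

/-!
# K3 gen-8 engine-flow child `KLRegimeEngineV17F2` (stmt-HubbardSuperconductivity-20437), stub (M) `stub_twoLeg_scale0` ON ITS LITERAL REGISTERED BINDERS
# — package `klEngGeo7` / `klEngQ7 P R` (token #12), thresholds `klEngC₃6 P R` / `klEngU₀9 P R c` (token #10)

Cell gate-hubbard-kl, seat p1b (g8), (M) owner.  One application of p1b's generic scale-`0` closer
`twoLegStepV17F2_zero_of_readJetBound_bareSlopes` (…TwoLegStepV17F2ZeroCloser) at the REGISTERED package `klEngGeo7` / `klEngQ7 P R`
(k3c2-p1's `…EngineV8DefsQ7`: `klEngQ7 P R = (klEngQ6 P R).raiseCEOnly (klWtCE R)`, all slots but `CE` unchanged — `klEngQ7_S'`, `klEngQ7_CL` are `rfl`)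
and tables `klC4aJetC` / `klC4aJetC' P R`, with the regime converted from the registered thresholds
(`c ≤ klEngC₃6 P R ≤ klCurveC3 R`, `U ≤ klEngU₀9 P R c ≤ klEngU₀3 ≤ klCurveU0 R ∧ ≤ 1`), the covariance number `a₁ := klE3A1 R`
(`bareAlphaOne_le_klE3A1`) and the four scale-`0` numerals discharged by the (E3-THR) door `bareFrame_numerals_of_le_klEngU₀9` (…DefsU9),
the package lines `klC4aJetC_le_klEngGeo7_S` (r2d-p1) / `klC4aJetC'_le_klEngQ6_S'` (c4a-1, transported along `klEngQ7_S'`) and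
`klEngQ6_CL_nonneg` (along `klEngQ7_CL`):
**`stub_twoLeg_scale0_of_nestedLegs_Q7U9`** — (M)'s literal registered binders + the two nested-leg rates `hcut`/`hsp` of the scale-`0` local part
(VL lanes; empty histories) ⇒ `TwoLegStepV17F2 L M klEngGeo7 P (klEngQ7 P R) R β U μ 0`.  So (M) = stub 6-F@0 ∘ THIS ∘ (C).
§2 discharges the cutoff leg `hcut` BY NAME with k3c4-p2's `TwoVolumeDefect.twoLeg_scale0_hcutF_of_klEng` (…TwoCutoffScaleZeroLegF) along the
`rfl` rows `klEngQ7_M0`/`klEngQ7_CL` and `klEngU₀9 ≤ klEngU₀4`: **`stub_twoLeg_scale0_of_spLeg_Q7U9`** — (M)'s registered binders + ONLY the spatial leg `hsp`.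
Proofs only; no definitions.
References: BGM 2006 §3 (3.2)–(3.3), (2.40) [cite: BenfattoGiulianiMastropietro2006].
-/

noncomputable section

namespace Summit.HubbardSuperconductivity.HubbardSuperconductivity.Theorems.EngineV8

set_option linter.dupNamespace false -- summit = problem name (single-conjunct summit), D-0017

open Real Finset Literature.MathematicalPhysics.QuantumLattice Literature.Probability.LatticeModels
open Literature.MathematicalPhysics.QuantumLattice.FermiRG Literature.MathematicalPhysics.QuantumLattice.BandSectorCounting
open Summit.HubbardSuperconductivity.HubbardSuperconductivity.Theorems.KLProgrammeLegKernels
open Summit.HubbardSuperconductivity.HubbardSuperconductivity.Theorems.DispersionFlow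
open Summit.HubbardSuperconductivity.HubbardSuperconductivity.Theorems.PerturbedFermiCurve
open Summit.HubbardSuperconductivity.HubbardSuperconductivity.Theorems.KLRegimeSplit
open Summit.HubbardSuperconductivity.HubbardSuperconductivity.Theorems.TwoVolumeDefect

/-! ## §1 (M) from the two nested-leg rates -/

/-- **STUB (M) ON ITS LITERAL REGISTERED BINDERS** (package `klEngQ7 P R`, door `klEngU₀9 P R c`): from the registered binders (`P.WF`, `R.WF2`,
`0 < c ≤ klEngC₃6 P R`, `μ ∈ klWindowC`, `0 < U ≤ klEngU₀9 P R c`, `klBetaMin ≤ β ≤ e^{c/U²}`, the volume thresholds, `FrameOK … (klFlowFrameU … 0)`,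
the scale-`0` engine bounds at `klEngQ7 P R`, stub 6-F's scale-`0` reading jets) and the two nested-leg rates of the scale-`0` local part (cutoff-removal
`hcut`, thermodynamic `hsp`, tolerance `(klEngQ7 P R).CL β 0 / 4 / L₁`): `TwoLegStepV17F2 L M klEngGeo7 P (klEngQ7 P R) R β U μ 0`. -/
theorem stub_twoLeg_scale0_of_nestedLegs_Q7U9 (P : SplitConsts) (R : RenConsts) (c : ℝ) (hP : P.WF) (hR : R.WF2) (hc : 0 < c)
    (hc3 : c ≤ klEngC₃6 P R) (μ : ℝ) (hμ : μ ∈ klWindowC) (U : ℝ) (hU : 0 < U) (hUle : U ≤ klEngU₀9 P R c) (β : ℝ) (hβ : klBetaMin ≤ β)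
    (hβc : β ≤ Real.exp (c / U ^ 2)) (L M : ℕ) [NeZero L] [NeZero M] (hL : klEngL₃ β U ≤ L) (hM : klEngM₃ β U L ≤ M)
    (hfr : FrameOK R U (nScales β) μ (klFlowFrameU L M β U μ 0))
    (hE : EngineBoundsAtV17F2 L M klEngGeo7 P (klEngQ7 P R) β U μ 0)
    (hJ : TwoLegReadJetBound L M klC4aJetC (klC4aJetC' P R) β U μ (klFlowFrameU L M β U μ 0) 0)
    (hcut : ∀ (Mq : ℕ → ℕ) (L₁ M₁ M₂ : ℕ) [NeZero L₁] [NeZero M₁] [NeZero M₂], L ≤ L₁ → (klEngQ7 P R).M0 β L₁ ≤ M₁ → Mq L₁ ≤ M₁ →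
      M₁ ≤ M₂ →
      (∀ j < 0, histV17F2 L₁ M₁ klEngGeo7 P (klEngQ7 P R) R β U μ j ∧ TwoLegSlopes L₁ M₁ R β U μ (klFlowFrameU L₁ M₁ β U μ j) j) →
      (∀ j < 0, histV17F2 L₁ M₂ klEngGeo7 P (klEngQ7 P R) R β U μ j ∧ TwoLegSlopes L₁ M₂ R β U μ (klFlowFrameU L₁ M₂ β U μ j) j) →
        ∀ θ : ℝ, |klLocalPart L₁ M₁ β U μ (klFlowFrameU L₁ M₁ β U μ 0) 0 θ -
          klLocalPart L₁ M₂ β U μ (klFlowFrameU L₁ M₂ β U μ 0) 0 θ| ≤ (klEngQ7 P R).CL β 0 / 4 / L₁)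
    (hsp : ∀ (Mq : ℕ → ℕ) (L₁ L₂ M₂ : ℕ) [NeZero L₁] [NeZero L₂] [NeZero M₂], L ≤ L₁ → L₁ ∣ L₂ → (klEngQ7 P R).M0 β L₁ ≤ M₂ →
      Mq L₁ ≤ M₂ → (klEngQ7 P R).M0 β L₂ ≤ M₂ → Mq L₂ ≤ M₂ →
      (∀ j < 0, histV17F2 L₁ M₂ klEngGeo7 P (klEngQ7 P R) R β U μ j ∧ TwoLegSlopes L₁ M₂ R β U μ (klFlowFrameU L₁ M₂ β U μ j) j) →
      (∀ j < 0, histV17F2 L₂ M₂ klEngGeo7 P (klEngQ7 P R) R β U μ j ∧ TwoLegSlopes L₂ M₂ R β U μ (klFlowFrameU L₂ M₂ β U μ j) j) →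
        ∀ θ : ℝ, |klLocalPart L₁ M₂ β U μ (klFlowFrameU L₁ M₂ β U μ 0) 0 θ -
          klLocalPart L₂ M₂ β U μ (klFlowFrameU L₂ M₂ β U μ 0) 0 θ| ≤ (klEngQ7 P R).CL β 0 / 4 / L₁) :
    TwoLegStepV17F2 L M klEngGeo7 P (klEngQ7 P R) R β U μ 0 := by
  have _ := hP; have _ := hfr; have _ := hE
  have hRge : ∀ j, 0 ≤ R.Gfr j := hR.1.2.2
  have hcle : c ≤ klCurveC3 R := hc3.trans ((klEngC₃6_le_klEngC₃3 P R).trans (klEngC₃3_le_klCurveC3 P hRge))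
  have hU3 : U ≤ klEngU₀3 P R c := hUle.trans (klEngU₀9_le_klEngU₀3 P R c)
  have hUle' : U ≤ klCurveU0 R := hU3.trans (klEngU₀3_le_klCurveU0 P hRge c)
  have hU1 : U ≤ 1 := le_one_of_le_klEngU₀3 hU3
  have hU1' : |U| ≤ 1 := by rw [abs_of_pos hU]; exact hU1
  obtain ⟨hs0, hs1, hfz, hf1⟩ := bareFrame_numerals_of_le_klEngU₀9 P hR.2.2 hU hUle
  exact twoLegStepV17F2_zero_of_readJetBound_bareSlopes klEngGeo7 (klEngQ7 P R) hR.1 hc hcle hμ hU hUle' hU1 hβ hβc hL hM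
    ((by rw [klEngQ7_CL]; exact klEngQ6_CL_nonneg P R β 0)) klC4aJetC_le_klEngGeo7_S (fun k => by rw [klEngQ7_S']; exact klC4aJetC'_le_klEngQ6_S' P R k) hJ (klE3A1_pos R)
    (bareAlphaOne_le_klE3A1 R hU1') hs0 hs1 hfz hf1 hcut hsp

/-! ## §2 The cutoff nested leg discharged (k3c4-p2's door, re-keyed to `klEngQ7`) -/

/-- **STUB (M) ON ITS LITERAL REGISTERED BINDERS, CUTOFF LEG DISCHARGED** (package `klEngQ7 P R`, door `klEngU₀9 P R c`): from the registered
binders and ONLY the spatial nested-leg rate `hsp` of the scale-`0` local part (tolerance `(klEngQ7 P R).CL β 0 / 4 / L₁`):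
`TwoLegStepV17F2 L M klEngGeo7 P (klEngQ7 P R) R β U μ 0`.  The cutoff leg is k3c4-p2's `twoLeg_scale0_hcutF_of_klEng` along `klEngQ7_M0`/`klEngQ7_CL`. -/
theorem stub_twoLeg_scale0_of_spLeg_Q7U9 (P : SplitConsts) (R : RenConsts) (c : ℝ) (hP : P.WF) (hR : R.WF2) (hc : 0 < c)
    (hc3 : c ≤ klEngC₃6 P R) (μ : ℝ) (hμ : μ ∈ klWindowC) (U : ℝ) (hU : 0 < U) (hUle : U ≤ klEngU₀9 P R c) (β : ℝ) (hβ : klBetaMin ≤ β)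
    (hβc : β ≤ Real.exp (c / U ^ 2)) (L M : ℕ) [NeZero L] [NeZero M] (hL : klEngL₃ β U ≤ L) (hM : klEngM₃ β U L ≤ M)
    (hfr : FrameOK R U (nScales β) μ (klFlowFrameU L M β U μ 0))
    (hE : EngineBoundsAtV17F2 L M klEngGeo7 P (klEngQ7 P R) β U μ 0)
    (hJ : TwoLegReadJetBound L M klC4aJetC (klC4aJetC' P R) β U μ (klFlowFrameU L M β U μ 0) 0)
    (hsp : ∀ (Mq : ℕ → ℕ) (L₁ L₂ M₂ : ℕ) [NeZero L₁] [NeZero L₂] [NeZero M₂], L ≤ L₁ → L₁ ∣ L₂ → (klEngQ7 P R).M0 β L₁ ≤ M₂ →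
      Mq L₁ ≤ M₂ → (klEngQ7 P R).M0 β L₂ ≤ M₂ → Mq L₂ ≤ M₂ →
      (∀ j < 0, histV17F2 L₁ M₂ klEngGeo7 P (klEngQ7 P R) R β U μ j ∧ TwoLegSlopes L₁ M₂ R β U μ (klFlowFrameU L₁ M₂ β U μ j) j) →
      (∀ j < 0, histV17F2 L₂ M₂ klEngGeo7 P (klEngQ7 P R) R β U μ j ∧ TwoLegSlopes L₂ M₂ R β U μ (klFlowFrameU L₂ M₂ β U μ j) j) →
        ∀ θ : ℝ, |klLocalPart L₁ M₂ β U μ (klFlowFrameU L₁ M₂ β U μ 0) 0 θ -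
          klLocalPart L₂ M₂ β U μ (klFlowFrameU L₂ M₂ β U μ 0) 0 θ| ≤ (klEngQ7 P R).CL β 0 / 4 / L₁) :
    TwoLegStepV17F2 L M klEngGeo7 P (klEngQ7 P R) R β U μ 0 := by
  refine stub_twoLeg_scale0_of_nestedLegs_Q7U9 P R c hP hR hc hc3 μ hμ U hU hUle β hβ hβc L M hL hM hfr hE hJ ?_ hsp
  intro Mq L₁ M₁ M₂ _ _ _ hLL₁ hM0 hMq h12 h₁ h₂ θ
  rw [klEngQ7_M0] at hM0
  rw [klEngQ7_CL]
  exact twoLeg_scale0_hcutF_of_klEng P hR.1 c hμ hU (hUle.trans (klEngU₀9_le_klEngU₀4 P R c)) hβ hL hfr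
    (fun (L' M' : ℕ) [NeZero L'] [NeZero M'] (j : ℕ) =>
      histV17F2 L' M' klEngGeo7 P (klEngQ7 P R) R β U μ j ∧ TwoLegSlopes L' M' R β U μ (klFlowFrameU L' M' β U μ j) j)
    Mq L₁ M₁ M₂ hLL₁ hM0 hMq h12 h₁ h₂ θ

end Summit.HubbardSuperconductivity.HubbardSuperconductivity.Theorems.EngineV8

end
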